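import Summits.AnomalousDissipation.AnomalousDissipation.Theorems.TwoAndHalfDTwohalfdNegReductionOffZero
import Summits.AnomalousDissipation.AnomalousDissipation.Theorems.TwoAndHalfDTwohalfdThesisStubPlanarSubLogNoGo
import Summits.AnomalousDissipation.AnomalousDissipation.Theorems.TwoAndHalfDTwohalfdThesisStubStrainSqLeEnstrophy
import Summits.AnomalousDissipation.AnomalousDissipation.Theorems.TwoAndHalfDTwohalfdThesisStubPlanarEnstrophyCeiling
import Summits.AnomalousDissipation.AnomalousDissipation.Theorems.TwoAndHalfDTwohalfdThesisStubUniformLogStrain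
import Summits.AnomalousDissipation.AnomalousDissipation.Theorems.TwoAndHalfDTwohalfdThesisStubWitnessWindow
import Literature.Analysis.FluidPDE.TwoHalfSection
import Literature.Analysis.FluidPDE.LerayHopfGalileanTorusMeans
import Literature.Analysis.FluidPDE.LerayHopfTimeSliceTorus
import Literature.Analysis.FluidPDE.LongTimeAverageNonneg

/-!
# P-CERT `stub_uniformWindow` — the witness window with constants depending only on the force and the budget
# (line `Sketch`, crux stmt-AnomalousDissipation-0206)

Registered assembly stub (section P) of the line `Sketch` (duhamel-release) for the crux
`Summit.AnomalousDissipation.AnomalousDissipation.Theses.TwoAndHalfD.TwohalfdThesis` (= X,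
stmt-AnomalousDissipation-0206).  Section O (`stub_witnessWindow`, O-CERT) put the planar section
`v_j = π_E ∘ u_j ∘ ι` of every X-witness in the window
`c·log(1/ν_j) ≤ ⟨‖∇v_j‖₂⟩`, `c²·log²(1/ν_j) ≤ ⟨‖∇v_j‖₂²⟩ ≤ C·ν_j^{-1/2}` with constants depending on the witness.
Here the constants are UNIFORM: for every admissible force `f`, energy level `E` and floor `ε > 0` there are
`c = c(f, E, ε) > 0` (P1 `stub_uniformLogStrain`, diagonal extraction + O1) and `C = C(f, E) ≥ 0`
(`C = √(K √E E)`, `K = sup ‖Δg‖` for the planar part `g = π_E ∘ f ∘ ι`, Alexakis–Doering O4 along the planar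
Leray–Hopf flow of the reduction, whose mean energy is at most `meanEnergy u_j ≤ E` by
`ReductionOffZero.meanEnergy_planar_le`) serving EVERY vanishing-viscosity family of `x₃`-invariant global
Leray–Hopf solutions forced by `f` with `meanEnergy ≤ E` and `meanDissipation ≥ ε`; the `log²` floor uses O3
(Jensen) with the uniform `c²`.  Supports stmt-AnomalousDissipation-0206.

## Mathlib / Literature search

`lean search 'meanEnergy_planar_le'` (`…TwohalfdNegReductionOffZero`), `'meanEnergy_congr_of_eqOn_Ioi'`
(`LerayHopfGalileanTorusMeans`), `'planarProjE_twoHalf_planarSect'` (`TwoHalfSection`),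
`'exists_nonneg_forall_norm_le_of_continuous'` (`LerayHopfTimeSliceTorus`), `'stub_uniformWindow'` (nothing);
`lean find`: nothing to adapt.
-/

noncomputable section

-- the summit path AnomalousDissipation/AnomalousDissipation duplicates a namespace component
set_option linter.dupNamespace false

namespace Summit.AnomalousDissipation.AnomalousDissipation.Theorems.TwohalfdThesis

open MeasureTheory Set Filter Topology
open scoped ENNReal NNReal
open Literature.Analysis.FunctionSpaces Literature.Analysis.FluidPDE
open Summit.AnomalousDissipation.AnomalousDissipation.Theorems.TwohalfdNeg

/-- **The planar flow of the reduction has mean energy at most the family's.**  If `u t = twoHalf (v t) (θ t)` for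
`t ≠ 0` along an `x₃`-invariant global Leray–Hopf solution `u` (steady mean-zero `L²` force, `ν > 0`), then
`meanEnergy v ≤ meanEnergy u` (`ReductionOffZero.meanEnergy_planar_le` for the section `π_E ∘ u ∘ ι`, which agrees
with `v` off `t = 0`; the means only see positive times). [folklore] -/
theorem meanEnergy_le_of_twoHalf_section {ν : ℝ} {f u₀ : UnitAddTorus (Fin 3) → EuclideanSpace ℝ (Fin 3)}
    {u : ℝ → UnitAddTorus (Fin 3) → EuclideanSpace ℝ (Fin 3)}
    {v : ℝ → UnitAddTorus (Fin 2) → EuclideanSpace ℝ (Fin 2)} {θ : ℝ → UnitAddTorus (Fin 2) → ℝ}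
    (hν : 0 < ν) (hf : MemLp f 2 volume) (hfz : Torus.HasZeroMean f)
    (hLH : Torus.IsGlobalLerayHopf ν (fun _ => f) u₀ u)
    (huinv : ∀ (t : ℝ) (s : UnitAddCircle) (x : UnitAddTorus (Fin 3)), u t (x + Pi.single (2 : Fin 3) s) = u t x)
    (hsec : ∀ t : ℝ, t ≠ 0 → u t = Torus.twoHalf (v t) (θ t)) :
    meanEnergy v ≤ meanEnergy u := by
  have hupd : meanEnergy v =
      meanEnergy (Function.update (fun t y => Torus.planarProjE (u t (Torus.planarSect y))) 0 (v 0)) := by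
    refine meanEnergy_congr_of_eqOn_Ioi fun t ht => ?_
    rw [Function.update_of_ne ht.ne']
    funext y
    rw [hsec t ht.ne']
    exact (Torus.planarProjE_twoHalf_planarSect (v t) (θ t) y).symm
  rw [hupd]
  exact ReductionOffZero.meanEnergy_planar_le hν hf hfz hLH huinv

/-- **P-CERT `stub_uniformWindow` — THE WITNESS WINDOW WITH UNIFORM CONSTANTS.**  For every `x₃`-invariant smooth
solenoidal mean-zero steady force `f` on `T³`, every energy level `E` and every floor `ε > 0` there are
`c > 0` and `C ≥ 0` such that EVERY family `(ν, u₀, u)` of `x₃`-invariant global Leray–Hopf solutions forced by `f`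
with `ν_j > 0`, `ν_j → 0`, `meanEnergy (u j) ≤ E` and `ε ≤ meanDissipation (ν j) (u j)` satisfies, for its planar
section `v_j = π_E ∘ u_j ∘ ι`: (i) `c·log(1/ν_j) ≤ ⟨‖∇v_j‖₂⟩` eventually, (ii) `c²·log²(1/ν_j) ≤ ⟨‖∇v_j‖₂²⟩`
eventually, (iii) `⟨‖∇v_j‖₂²⟩ ≤ C·ν_j^{-1/2}` for all `j`.  Assembly: P1 (with O1) for `c`; the reduction
`ReductionOffZero.stub_reductionOffZero`, its planar part being `π_E ∘ f ∘ ι` itself, O3 (Jensen) for (ii) and O4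
(Alexakis–Doering, `C = √(K √E E)`, `K = sup‖Δ(π_E ∘ f ∘ ι)‖`, planar energy `≤ E` by
`meanEnergy_le_of_twoHalf_section`) for (iii). [folklore] -/
theorem stub_uniformWindow :
    ∀ f : UnitAddTorus (Fin 3) → EuclideanSpace ℝ (Fin 3),
      (∀ (s : UnitAddCircle) (x : UnitAddTorus (Fin 3)), f (x + Pi.single (2 : Fin 3) s) = f x) →
      Torus.IsSmooth f → Torus.IsDivFree f → Torus.HasZeroMean f →
      ∀ (E ε : ℝ), 0 < ε →
        ∃ c C : ℝ, 0 < c ∧ 0 ≤ C ∧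
          ∀ (ν : ℕ → ℝ) (u₀ : ℕ → UnitAddTorus (Fin 3) → EuclideanSpace ℝ (Fin 3))
            (u : ℕ → ℝ → UnitAddTorus (Fin 3) → EuclideanSpace ℝ (Fin 3)),
            (∀ j, 0 < ν j) → Tendsto ν atTop (𝓝 0) →
            (∀ j, Torus.IsGlobalLerayHopf (ν j) (fun _ => f) (u₀ j) (u j)) →
            (∀ j (t : ℝ) (s : UnitAddCircle) (x : UnitAddTorus (Fin 3)),
              u j t (x + Pi.single (2 : Fin 3) s) = u j t x) →
            (∀ j, meanEnergy (u j) ≤ E) → (∀ j, ε ≤ meanDissipation (ν j) (u j)) →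
            (∀ᶠ j in atTop, c * Real.log (ν j)⁻¹ ≤
              longTimeAvgSup (fun t => Real.sqrt (Torus.eGradNormSq
                (fun y : UnitAddTorus (Fin 2) => Torus.planarProjE (u j t (Torus.planarSect y)))).toReal)) ∧
            (∀ᶠ j in atTop, c ^ 2 * (Real.log (ν j)⁻¹) ^ 2 ≤
              longTimeAvgSup (fun t => (Torus.eGradNormSq
                (fun y : UnitAddTorus (Fin 2) => Torus.planarProjE (u j t (Torus.planarSect y)))).toReal)) ∧
            (∀ j, longTimeAvgSup (fun t => (Torus.eGradNormSq
                (fun y : UnitAddTorus (Fin 2) => Torus.planarProjE (u j t (Torus.planarSect y)))).toReal) ≤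
              C * Real.sqrt (ν j)⁻¹) := by
  intro f hfinv hfs hfd hfz E ε hε
  -- the planar part `g = π_E ∘ f ∘ ι` of the force and the bound `K` of its Laplacian
  set g : UnitAddTorus (Fin 2) → EuclideanSpace ℝ (Fin 2) :=
    fun y => Torus.planarProjE (f (Torus.planarSect y)) with hg
  have hfe : f = Torus.twoHalf g (fun y => f (Torus.planarSect y) 2) :=
    Torus.eq_twoHalf_of_forall_add_single' hfinv
  have hgs : Torus.IsSmooth g := Torus.isSmooth_left_of_twoHalf (hfe ▸ hfs)
  obtain ⟨K, hK, hgK⟩ :=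
    Torus.exists_nonneg_forall_norm_le_of_continuous hgs.laplacian.continuous
  -- the uniform floor constant (P1 fed with O1)
  obtain ⟨c, hc, hcP⟩ := stub_uniformLogStrain stub_planarSubLogNoGo f hfinv hfs hfd hfz E ε hε
  refine ⟨c, Real.sqrt (K * (Real.sqrt E * E)), hc, Real.sqrt_nonneg _,
    fun ν u₀ u hν hν0 hLH huinv hE hfl => ?_⟩
  have hi := hcP ν u₀ u hν hν0 hLH huinv hE hfl
  -- the reduction to the planar Leray–Hopf flows `v_j`; its planar force is `g` itself
  obtain ⟨g', h', v₀, v, θ₀, θ, hgs', -, hgz', -, -, hfe', hsec, hvLH, -, -, -, -, -⟩ :=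
    ReductionOffZero.stub_reductionOffZero f hfinv hfs hfd hfz ν u₀ u hν hLH huinv ⟨E, hE⟩
  have hgg : g' = g := Torus.twoHalf_left_injective (hfe'.symm.trans hfe)
  have hgK' : ∀ x, ‖Torus.laplacian g' x‖ ≤ K := hgg ▸ hgK
  have hEv : ∀ j, meanEnergy (v j) ≤ E := fun j =>
    (meanEnergy_le_of_twoHalf_section (hν j) (hfs.memLp 2) hfz (hLH j) (huinv j) (hsec j)).trans (hE j)
  have hid : ∀ j, longTimeAvgSup (fun t => (Torus.eGradNormSq
      (fun y : UnitAddTorus (Fin 2) => Torus.planarProjE (u j t (Torus.planarSect y)))).toReal) =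
      longTimeAvgSup (fun t => (Torus.eGradNormSq (v j t)).toReal) := fun j =>
    longTimeAvgSup_eGradNormSq_planarSection_eq (hsec j)
  have hidsqrt : ∀ j, longTimeAvgSup (fun t => Real.sqrt (Torus.eGradNormSq
      (fun y : UnitAddTorus (Fin 2) => Torus.planarProjE (u j t (Torus.planarSect y)))).toReal) =
      longTimeAvgSup (fun t => Real.sqrt (Torus.eGradNormSq (v j t)).toReal) := fun j =>
    longTimeAvgSup_sqrt_eGradNormSq_planarSection_eq (hsec j)
  refine ⟨hi, ?_, fun j => ?_⟩
  · -- (ii): Jensen along `v_j` with the uniform `c`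
    filter_upwards [hi, eventually_log_inv_nonneg hν hν0] with j hj hlog
    have hO3 := stub_strainSqLeEnstrophy (ν j) g' (v₀ j) (v j) (hν j) (hgs'.memLp 2) hgz' (hvLH j)
    have hcl : 0 ≤ c * Real.log (ν j)⁻¹ := mul_nonneg hc.le hlog
    rw [hid j]
    calc c ^ 2 * (Real.log (ν j)⁻¹) ^ 2 = (c * Real.log (ν j)⁻¹) ^ 2 := by ring
      _ ≤ (longTimeAvgSup (fun t => Real.sqrt (Torus.eGradNormSq
            (fun y : UnitAddTorus (Fin 2) => Torus.planarProjE (u j t (Torus.planarSect y)))).toReal)) ^ 2 :=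
          pow_le_pow_left₀ hcl hj 2
      _ = (longTimeAvgSup (fun t => Real.sqrt (Torus.eGradNormSq (v j t)).toReal)) ^ 2 := by
          rw [hidsqrt j]
      _ ≤ longTimeAvgSup (fun t => (Torus.eGradNormSq (v j t)).toReal) := hO3
  · -- (iii): Alexakis–Doering along `v_j`, planar energy `≤ E`
    rw [hid j]
    calc longTimeAvgSup (fun t => (Torus.eGradNormSq (v j t)).toReal)
        ≤ Real.sqrt (K * (Real.sqrt E * E) / ν j) :=
          stub_planarEnstrophyCeiling (ν j) K E g' (v₀ j) (v j) (hν j) hgs' hgz' hK hgK' (hvLH j) (hEv j)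
      _ = Real.sqrt (K * (Real.sqrt E * E)) * Real.sqrt (ν j)⁻¹ := by
          rw [div_eq_mul_inv, Real.sqrt_mul' _ (inv_nonneg.2 (hν j).le)]

end Summit.AnomalousDissipation.AnomalousDissipation.Theorems.TwohalfdThesis

end
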